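import Literature.NumberTheory.Automorphic.GlobalWhittakerCoefficient
import Literature.NumberTheory.Automorphic.AdelicFundamentalDomain
import Literature.NumberTheory.Automorphic.UnipotentAdelicCompact
import Literature.NumberTheory.Automorphic.ReductionTheoryGLnConjugation
import Literature.NumberTheory.Automorphic.LatticeUnimodular
import Literature.NumberTheory.Automorphic.GLnAdelicLocallyCompact
import Literature.NumberTheory.Automorphic.AdelicSecondCountable
import Literature.NumberTheory.Automorphic.QuaternionAlgebraAdelicProofs
import HarnessLib

/-!
# Tate's fundamental domain for `N_n(K)` in `N_n(𝔸_K)`, and the Haar measure of `N_n(𝔸_K)`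

Topic `NumberTheory/Automorphic`; namespace `Literature.NumberTheory.Automorphic`. A brick of the
mean-square route to Jacquet–Shalika's Theorem (5.3) (`StandardLFunctionData.multipliable_L`,
files `JacquetShalikaSchurSelfSum`, `WhittakerCoeffLocalDatum`, `WhittakerCoeffCuspidal`): the
global Whittaker coefficient `whittakerCoeff ν 𝓕 ψ φ` (`GlobalWhittakerCoefficient`) is an integral
over a fundamental domain `𝓕` of `N_n(K)` (`rationalUnipotent n K`) in the upper unitriangular
group `N_n(𝔸_K)` (`adelicUnipotent n K`) for a measure `ν`, and the theorems of
`WhittakerCoeffCuspidal` ask for: `ν` right invariant and finite on compact sets, invariant under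
`N_n(K)`, `𝓕` a measurable fundamental domain with compact closure, `N_n(K)` countable and acting
measurably. This file **produces** such a pair, for every `n` and every number field `K`:

* `unipotentTateDomain n K = 𝓕_N = {u ∈ N_n(𝔸_K) | u i j ∈ D for all i < j}`, the box over Tate's
  additive fundamental domain `D = D_∞ × ∏_v 𝒪_v ⊆ 𝔸_K` of `K` in `𝔸_K` (`adeleFundamentalDomain`,
  Cassels–Fröhlich Ch. XV, Def. 4.1.2, Thm. 4.1.3);
* `existsUnique_smul_mem_unipotentTateDomain` — **every `u ∈ N_n(𝔸_K)` has exactly one left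
  `N_n(K)`-translate in `𝓕_N`**: the entries of `γ u` above the diagonal are
  `(γ u) i j = u i j + γ i j + ∑_{i<k<j} γ i k · u k j`, a triangular system solved entry by entry,
  in the order of `j - i`, by Tate's `𝔸_K = ⨆_{ξ ∈ K} (ξ + D)` (existence is the column-by-column
  reduction `exists_unitriangular_rational_mul_mem` of `UnipotentAdelicCompact`; uniqueness is
  proved here by induction on `j - i`);
* hence (`isFundamentalDomain_unipotentTateDomain`) `𝓕_N` is a measurable fundamental domain
  (Mathlib `IsFundamentalDomain`) for the left action of `N_n(K)`, for **every** measure, with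
  compact closure (`isCompact_closure_unipotentTateDomain`), of finite (`measure_unipotentTateDomain_lt_top`)
  and positive (`measure_unipotentTateDomain_pos`) Haar measure;
* the instances consumed downstream: `N_n(𝔸_K)` is a closed subgroup of `GL_n(𝔸_K)`, locally
  compact, Hausdorff and second countable; `N_n(K)` is countable;
* `isMulRightInvariant_of_isHaarMeasure_adelicUnipotent` — **every left Haar measure on
  `N_n(𝔸_K)` is right invariant** (`N_n(𝔸_K)` is unimodular), deduced from the existence of the
  lattice `N_n(K)` with the fundamental domain `𝓕_N` of finite positive measure
  (`isMulRightInvariant_of_isFundamentalDomain` of `LatticeUnimodular`), with no computation of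
  the group law in coordinates;
* `exists_isHaarMeasure_isFundamentalDomain_adelicUnipotent` — the bundle handed to
  `WhittakerCoeffCuspidal.whittakerCoeff_smoothedForm_ofLocal_piPowGL_eq`.

Everything is proved; folklore (Tate's thesis, Cassels–Fröhlich Ch. XV §4.1, for `n(n-1)/2`
coordinates; Cogdell, *Lectures on L-functions, converse theorems, and functoriality for GL_n*
(2004), §1.1: "`N_n(k) \ N_n(𝔸)` is compact" and the Whittaker coefficient is an integral over it).

## References

* J. W. S. Cassels, A. Fröhlich (eds.), *Algebraic Number Theory* (1967), Ch. XV (Tate), §4.1,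
  Def. 4.1.2, Thm. 4.1.3, Cor. 4.1.1 [CasselsFrohlichANT1967].
* J. W. Cogdell, *Lectures on L-functions, converse theorems, and functoriality for GL_n*, in
  *Lectures on automorphic L-functions*, Fields Inst. Monogr. 20 (2004), §1.1
  [CogdellAnalyticTheory2004].
-/

noncomputable section

open MeasureTheory Measure NumberField IsDedekindDomain Matrix Set
open scoped MatrixGroups ENNReal

namespace Literature.NumberTheory.Automorphic

/-! ### `N_n(𝔸_K)` as a locally compact second countable group; `N_n(K)` is countable -/

section Topology

variable (n : ℕ) (K : Type) [Field K] [NumberField K]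

/-- `GL_n(K)` is countable for a number field `K` (it injects into the countable
`M_n(K) = K^{n × n}`, `K` being countable, `countable_numberField`). [folklore] -/
theorem countable_generalLinearGroup_numberField : Countable (GL (Fin n) K) := by
  haveI := countable_numberField K
  haveI : Countable (Matrix (Fin n) (Fin n) K) := inferInstanceAs (Countable (Fin n → Fin n → K))
  exact Function.Injective.countable
    (f := fun g : GL (Fin n) K => (g : Matrix (Fin n) (Fin n) K)) Units.val_injective

/-- **`N_n(K)` is countable**: `rationalUnipotent n K` injects into the range of the diagonal
embedding `GL_n(K) → GL_n(𝔸_K)`, a countable set. (Instance: it feeds the `[Countable _]`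
hypotheses of `GlobalWhittakerCoefficient` and `WhittakerCoeffCuspidal`.) [folklore] -/
instance countable_rationalUnipotent : Countable ↥(rationalUnipotent n K) := by
  haveI := countable_generalLinearGroup_numberField n K
  set f := (Matrix.GeneralLinearGroup.map (algebraMap K (AdeleRing (𝓞 K) K)) : GL (Fin n) K → _)
  have hrange : ∀ γ : ↥(rationalUnipotent n K),
      ((γ : ↥(adelicUnipotent n K)) : GL (Fin n) (AdeleRing (𝓞 K) K)) ∈ range f := by
    intro γ
    obtain ⟨g, hg⟩ := (mem_rationalUnipotent_iff (γ : ↥(adelicUnipotent n K))).1 γ.2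
    exact ⟨g, hg⟩
  haveI : Countable (range f) := (countable_range f).to_subtype
  refine Function.Injective.countable (f := fun γ : ↥(rationalUnipotent n K) =>
    (⟨_, hrange γ⟩ : range f)) fun a b h => ?_
  have h' := congrArg Subtype.val h
  exact Subtype.ext (Subtype.ext h')

/-- `N_n(𝔸_K)` is closed in `GL_n(𝔸_K)` (`isClosed_upperUnitriangular`; `𝔸_K` is Hausdorff).
[folklore] -/
theorem isClosed_adelicUnipotent :
    IsClosed ((adelicUnipotent n K : Subgroup (GL (Fin n) (AdeleRing (𝓞 K) K))) :
      Set (GL (Fin n) (AdeleRing (𝓞 K) K))) := by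
  haveI := t2Space_adeleRing K
  exact isClosed_upperUnitriangular

/-- `N_n(𝔸_K)` is Hausdorff. [folklore] -/
instance t2Space_adelicUnipotent : T2Space ↥(adelicUnipotent n K) := by
  haveI := t2Space_adeleRing K
  infer_instance

/-- `N_n(𝔸_K)` is locally compact (a closed subgroup of the locally compact `GL_n(𝔸_K)`,
`AdelicGroupData.locallyCompactSpace_generalLinearGroup_adeleRing`). [folklore] -/
instance locallyCompactSpace_adelicUnipotent : LocallyCompactSpace ↥(adelicUnipotent n K) := by
  haveI := AdelicGroupData.locallyCompactSpace_generalLinearGroup_adeleRing K (Fin n)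
  exact (isClosed_adelicUnipotent n K).isClosedEmbedding_subtypeVal.locallyCompactSpace

/-- `N_n(𝔸_K)` is second countable (`secondCountableTopology_generalLinearGroup_adeleRing`).
[folklore] -/
instance secondCountableTopology_adelicUnipotent :
    SecondCountableTopology ↥(adelicUnipotent n K) := by
  haveI := secondCountableTopology_generalLinearGroup_adeleRing K (Fin n)
  exact TopologicalSpace.Subtype.secondCountableTopology _

variable {n K}

/-- The entries `u ↦ u i j` are continuous on `N_n(𝔸_K)`. [folklore] -/
theorem continuous_adelicUnipotent_apply (i j : Fin n) :
    Continuous fun u : ↥(adelicUnipotent n K) =>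
      ((u : GL (Fin n) (AdeleRing (𝓞 K) K)) : Matrix (Fin n) (Fin n) (AdeleRing (𝓞 K) K)) i j :=
  (Units.continuous_val.comp continuous_subtype_val).matrix_elem i j

end Topology

/-! ### The triangular system `(γ u) i j = u i j + γ i j + ∑_{i<k<j} γ i k u k j` -/

section Algebra

variable {R : Type*} [CommRing R] {n : ℕ}

/-- For upper unitriangular `γ, u ∈ M_n(R)` and `i < j`:
`(γ u) i j = u i j + γ i j + ∑_{i < k < j} γ i k · u k j`. [folklore] -/
theorem unitriangular_mul_apply_of_lt {γ u : Matrix (Fin n) (Fin n) R}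
    (hγ : γ.BlockTriangular id) (hγd : ∀ i, γ i i = 1) (hu : u.BlockTriangular id)
    (hud : ∀ i, u i i = 1) {i j : Fin n} (hij : i < j) :
    (γ * u) i j = u i j + γ i j +
      ∑ k ∈ Finset.univ.filter (fun k : Fin n => i < k ∧ k < j), γ i k * u k j := by
  classical
  have hj : j ∈ (Finset.univ : Finset (Fin n)).erase i :=
    Finset.mem_erase.2 ⟨ne_of_gt hij, Finset.mem_univ j⟩
  rw [Matrix.mul_apply, ← Finset.add_sum_erase _ _ (Finset.mem_univ i),
    ← Finset.add_sum_erase _ _ hj, hγd, one_mul, hud, mul_one, add_assoc]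
  congr 2
  symm
  refine Finset.sum_subset (fun k hk => ?_) (fun k hk hk' => ?_)
  · simp only [Finset.mem_filter, Finset.mem_univ, true_and] at hk
    exact Finset.mem_erase.2 ⟨ne_of_lt hk.2, Finset.mem_erase.2 ⟨ne_of_gt hk.1, Finset.mem_univ k⟩⟩
  · simp only [Finset.mem_erase, Finset.mem_univ, and_true] at hk
    simp only [Finset.mem_filter, Finset.mem_univ, true_and, not_and_or, not_lt] at hk'
    rcases hk' with hk' | hk'
    · rw [hγ (lt_of_le_of_ne hk' hk.2), zero_mul]
    · rw [hu (lt_of_le_of_ne hk' (Ne.symm hk.1)), mul_zero]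

end Algebra

/-! ### Tate's box `𝓕_N` and the unique representability modulo `N_n(K)` -/

section Domain

variable (n : ℕ) (K : Type) [Field K] [NumberField K]

/-- **Tate's fundamental domain for `N_n(K)` in `N_n(𝔸_K)`**: the upper unitriangular adelic
matrices all of whose entries above the diagonal lie in Tate's additive fundamental domain
`D = D_∞ × ∏_v 𝒪_v` of `K` in `𝔸_K` (`adeleFundamentalDomain`; Cassels–Fröhlich Ch. XV,
Def. 4.1.2). [cite: CasselsFrohlichANT1967, Ch. XV Def. 4.1.2 and Thm. 4.1.3] -/
def unipotentTateDomain : Set ↥(adelicUnipotent n K) :=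
  {u | ∀ i j : Fin n, i < j →
    ((u : GL (Fin n) (AdeleRing (𝓞 K) K)) : Matrix (Fin n) (Fin n) (AdeleRing (𝓞 K) K)) i j ∈
      adeleFundamentalDomain K}

variable {n K}

/-- Membership in `𝓕_N` (definitional unfolding). [folklore] -/
theorem mem_unipotentTateDomain_iff {u : ↥(adelicUnipotent n K)} :
    u ∈ unipotentTateDomain n K ↔ ∀ i j : Fin n, i < j →
      ((u : GL (Fin n) (AdeleRing (𝓞 K) K)) : Matrix (Fin n) (Fin n) (AdeleRing (𝓞 K) K)) i j ∈
        adeleFundamentalDomain K :=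
  Iff.rfl

/-- `1 ∈ 𝓕_N` (`0 ∈ D`). [folklore] -/
theorem one_mem_unipotentTateDomain : (1 : ↥(adelicUnipotent n K)) ∈ unipotentTateDomain n K := by
  intro i j hij
  have : ((((1 : ↥(adelicUnipotent n K)) : GL (Fin n) (AdeleRing (𝓞 K) K)) :
      Matrix (Fin n) (Fin n) (AdeleRing (𝓞 K) K)) i j) = 0 := by
    rw [OneMemClass.coe_one, Units.val_one, Matrix.one_apply_ne (ne_of_lt hij)]
  rw [this]
  exact zero_mem_adeleFundamentalDomain K

/-- **Uniqueness in the triangular system.** Let `c ∈ M_n(𝔸_K)` be upper unitriangular with all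
entries above the diagonal in `D`, and let `δ ∈ M_n(K)` be upper unitriangular with all entries of
`δ c` above the diagonal in `D` as well. Then `δ = 1`: by induction on `j - i`, once `δ i k = 0`
for `i < k < j` one has `(δ c) i j = δ i j + c i j`, and `c i j`, `δ i j + c i j ∈ D` force
`δ i j = 0` (Tate's Thm. 4.1.3 (1): `D` meets every `K`-orbit exactly once).
[cite: CasselsFrohlichANT1967, Ch. XV Thm. 4.1.3 (1)] -/
theorem unitriangular_rational_eq_one_of_mul_mem {c : Matrix (Fin n) (Fin n) (AdeleRing (𝓞 K) K)}
    (hc : c.BlockTriangular id) (hcd : ∀ i, c i i = 1)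
    (hcD : ∀ i j, i < j → c i j ∈ adeleFundamentalDomain K)
    {δ : Matrix (Fin n) (Fin n) K} (hδ : δ.BlockTriangular id) (hδd : ∀ i, δ i i = 1)
    (hδD : ∀ i j, i < j → (δ.map (algebraMap K (AdeleRing (𝓞 K) K)) * c) i j ∈
      adeleFundamentalDomain K) :
    δ = 1 := by
  classical
  set A := algebraMap K (AdeleRing (𝓞 K) K) with hA
  -- the off-diagonal entries vanish, by strong induction on `j - i`
  have hmain : ∀ d : ℕ, ∀ i j : Fin n, i < j → (j : ℕ) - i = d → δ i j = 0 := by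
    intro d
    induction d using Nat.strong_induction_on with
    | _ d ih =>
      intro i j hij hd
      have hδA : (δ.map A).BlockTriangular id := fun a b hba => by
        rw [Matrix.map_apply, hδ hba, map_zero]
      have hδAd : ∀ i, δ.map A i i = 1 := fun i => by rw [Matrix.map_apply, hδd, map_one]
      have hentry := unitriangular_mul_apply_of_lt hδA hδAd hc hcd hij
      have hsum : ∑ k ∈ Finset.univ.filter (fun k : Fin n => i < k ∧ k < j),
          δ.map A i k * c k j = 0 := by
        refine Finset.sum_eq_zero fun k hk => ?_
        simp only [Finset.mem_filter, Finset.mem_univ, true_and] at hk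
        have hlt : (k : ℕ) - i < d := by
          rw [← hd]
          exact Nat.sub_lt_sub_right (le_of_lt (Fin.lt_def.1 hk.1)) (Fin.lt_def.1 hk.2)
        rw [Matrix.map_apply, ih _ hlt i k hk.1 rfl, map_zero, zero_mul]
      rw [hsum, add_zero, Matrix.map_apply] at hentry
      -- `c i j ∈ D` and `A (δ i j) + c i j ∈ D`
      have h1 : A (δ i j) + c i j ∈ adeleFundamentalDomain K := by
        rw [add_comm, ← hentry]; exact hδD i j hij
      have h0 : A 0 + c i j ∈ adeleFundamentalDomain K := by
        rw [map_zero, zero_add]; exact hcD i j hij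
      obtain ⟨ξ, -, huniq⟩ := existsUnique_add_algebraMap_mem_adeleFundamentalDomain K (c i j)
      rw [huniq _ h1, huniq _ h0]
  ext i j
  rcases lt_trichotomy i j with hij | rfl | hji
  · rw [hmain _ i j hij rfl, Matrix.one_apply_ne (ne_of_lt hij)]
  · rw [hδd, Matrix.one_apply_eq]
  · rw [hδ hji, Matrix.one_apply_ne (ne_of_gt hji)]

/-- **Tate's Theorem 4.1.3 (1) for `N_n`: `N_n(𝔸_K) = ⨆_{γ ∈ N_n(K)} γ · 𝓕_N`, a disjoint union.**
Every `u ∈ N_n(𝔸_K)` has exactly one left translate by an element of `N_n(K)`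
(`rationalUnipotent n K`, acting by left multiplication) inside `𝓕_N`. Existence is the
column-by-column reduction `exists_unitriangular_rational_mul_mem` (with `D` Tate's domain, which
meets every `K`-orbit); uniqueness is `unitriangular_rational_eq_one_of_mul_mem`.
[cite: CasselsFrohlichANT1967, Ch. XV Thm. 4.1.3 (1)] -/
theorem existsUnique_smul_mem_unipotentTateDomain (u : ↥(adelicUnipotent n K)) :
    ∃! γ : ↥(rationalUnipotent n K), γ • u ∈ unipotentTateDomain n K := by
  classical
  set A := algebraMap K (AdeleRing (𝓞 K) K) with hA
  have hD : ∀ x : AdeleRing (𝓞 K) K, ∃ k : K, x - A k ∈ adeleFundamentalDomain K := by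
    intro x
    obtain ⟨ξ, hξ, -⟩ := existsUnique_add_algebraMap_mem_adeleFundamentalDomain K x
    exact ⟨-ξ, by rwa [map_neg, sub_neg_eq_add, add_comm]⟩
  set U : Matrix (Fin n) (Fin n) (AdeleRing (𝓞 K) K) :=
    ((u : GL (Fin n) (AdeleRing (𝓞 K) K)) : Matrix (Fin n) (Fin n) (AdeleRing (𝓞 K) K)) with hU
  obtain ⟨hut, hud⟩ := (mem_upperUnitriangular_iff (u : GL (Fin n) (AdeleRing (𝓞 K) K))).1 u.2
  -- existence
  obtain ⟨γ, hγ, hγd, hγD⟩ := exists_unitriangular_rational_mul_mem K hD hut hud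
  have hγu : IsUnit γ := isUnit_of_blockTriangular_of_diag_eq_one hγ hγd
  set γ' : GL (Fin n) K := hγu.unit with hγ'
  have hγ'coe : (γ' : Matrix (Fin n) (Fin n) K) = γ := hγu.unit_spec
  set g : GL (Fin n) (AdeleRing (𝓞 K) K) := Matrix.GeneralLinearGroup.map A γ' with hg
  have hgcoe : (g : Matrix (Fin n) (Fin n) (AdeleRing (𝓞 K) K)) = γ.map A := by
    ext i j
    rw [hg, Matrix.GeneralLinearGroup.map_apply, Matrix.map_apply, hγ'coe]
  have hgmem : g ∈ adelicUnipotent n K := by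
    rw [mem_upperUnitriangular_iff, hgcoe]
    exact ⟨fun a b hba => by rw [Matrix.map_apply, hγ hba, map_zero],
      fun i => by rw [Matrix.map_apply, hγd i, map_one]⟩
  have hgrat : (⟨g, hgmem⟩ : ↥(adelicUnipotent n K)) ∈ rationalUnipotent n K :=
    (mem_rationalUnipotent_iff _).2 ⟨γ', rfl⟩
  refine ⟨⟨⟨g, hgmem⟩, hgrat⟩, ?_, ?_⟩
  · intro i j hij
    rw [Subgroup.smul_def, smul_eq_mul, Subgroup.coe_mul, Units.val_mul]
    change ((g : Matrix (Fin n) (Fin n) (AdeleRing (𝓞 K) K)) * U) i j ∈ _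
    rw [hgcoe]
    exact hγD i j hij
  -- uniqueness
  · rintro ⟨⟨g₂, hg₂mem⟩, hg₂rat⟩ hg₂
    obtain ⟨γ₂, hγ₂⟩ := (mem_rationalUnipotent_iff _).1 hg₂rat
    -- `γ₂ γ'⁻¹` is a rational unitriangular matrix fixing the box point `g u`
    have hγ'N : γ' ∈ upperUnitriangular (Fin n) K := by
      rw [mem_upperUnitriangular_iff, hγ'coe]; exact ⟨hγ, hγd⟩
    have hγ₂N : γ₂ ∈ upperUnitriangular (Fin n) K :=
      mem_upperUnitriangular_of_map_eq (u := ⟨g₂, hg₂mem⟩) hγ₂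
    set δ : GL (Fin n) K := γ₂ * γ'⁻¹ with hδ
    have hδN : δ ∈ upperUnitriangular (Fin n) K := mul_mem hγ₂N (inv_mem hγ'N)
    obtain ⟨hδt, hδd⟩ := (mem_upperUnitriangular_iff δ).1 hδN
    -- the box point `c = g u`
    set c : Matrix (Fin n) (Fin n) (AdeleRing (𝓞 K) K) :=
      (g : Matrix (Fin n) (Fin n) (AdeleRing (𝓞 K) K)) * U with hc
    have hcGL : ((g * (u : GL (Fin n) (AdeleRing (𝓞 K) K)) : GL (Fin n) (AdeleRing (𝓞 K) K)) :
        Matrix (Fin n) (Fin n) (AdeleRing (𝓞 K) K)) = c := by rw [Units.val_mul]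
    have hcmem : g * (u : GL (Fin n) (AdeleRing (𝓞 K) K)) ∈ adelicUnipotent n K := mul_mem hgmem u.2
    obtain ⟨hct, hcd⟩ := (mem_upperUnitriangular_iff _).1 hcmem
    rw [hcGL] at hct hcd
    have hcD : ∀ i j, i < j → c i j ∈ adeleFundamentalDomain K := by
      intro i j hij; rw [hc, hgcoe]; exact hγD i j hij
    -- `δ c = g₂ u`
    have hδc : (δ : Matrix (Fin n) (Fin n) K).map A * c =
        (g₂ : Matrix (Fin n) (Fin n) (AdeleRing (𝓞 K) K)) * U := by
      have h1 : ((Matrix.GeneralLinearGroup.map A δ : GL (Fin n) (AdeleRing (𝓞 K) K)) :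
          Matrix (Fin n) (Fin n) (AdeleRing (𝓞 K) K)) = (δ : Matrix (Fin n) (Fin n) K).map A := by
        ext i j; rw [Matrix.GeneralLinearGroup.map_apply, Matrix.map_apply]
      have h2 : Matrix.GeneralLinearGroup.map A δ * g = g₂ := by
        rw [hδ, map_mul, map_inv, hg, mul_assoc, inv_mul_cancel, mul_one, hγ₂]
      rw [← h1, hc, ← Matrix.mul_assoc, ← Units.val_mul, h2]
    have hδD : ∀ i j, i < j → ((δ : Matrix (Fin n) (Fin n) K).map A * c) i j ∈
        adeleFundamentalDomain K := by
      intro i j hij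
      rw [hδc]
      have := hg₂ i j hij
      rwa [Subgroup.smul_def, smul_eq_mul, Subgroup.coe_mul, Units.val_mul] at this
    have hδ1 : (δ : Matrix (Fin n) (Fin n) K) = 1 :=
      unitriangular_rational_eq_one_of_mul_mem hct hcd hcD hδt hδd hδD
    have hδ1' : δ = 1 := Units.ext hδ1
    have hγ₂eq : γ₂ = γ' := by
      rw [hδ, mul_inv_eq_one] at hδ1'
      exact hδ1'
    subst hγ₂eq
    refine Subtype.ext (Subtype.ext ?_)
    change g₂ = g
    have hγ₂' : Matrix.GeneralLinearGroup.map A γ' = g₂ := hγ₂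
    rw [← hγ₂', hg]

/-- `𝓕_N` is a Borel set (the entries are continuous and `D` is Borel,
`measurableSet_adeleFundamentalDomain`). [folklore] -/
theorem measurableSet_unipotentTateDomain [MeasurableSpace ↥(adelicUnipotent n K)]
    [BorelSpace ↥(adelicUnipotent n K)] : MeasurableSet (unipotentTateDomain n K) := by
  borelize (AdeleRing (𝓞 K) K)
  have : unipotentTateDomain n K = ⋂ i : Fin n, ⋂ j : Fin n, ⋂ (_ : i < j),
      (fun u : ↥(adelicUnipotent n K) =>
        ((u : GL (Fin n) (AdeleRing (𝓞 K) K)) : Matrix (Fin n) (Fin n) (AdeleRing (𝓞 K) K)) i j) ⁻¹'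
        adeleFundamentalDomain K := by
    ext u
    simp only [mem_unipotentTateDomain_iff, mem_iInter, mem_preimage]
  rw [this]
  exact MeasurableSet.iInter fun i => MeasurableSet.iInter fun j => MeasurableSet.iInter fun _ =>
    (continuous_adelicUnipotent_apply i j).measurable (measurableSet_adeleFundamentalDomain K)

/-- **`𝓕_N` is a measurable fundamental domain** for the left multiplication action of `N_n(K)` on
`N_n(𝔸_K)` (Mathlib `IsFundamentalDomain`, from exact unique representability,
`IsFundamentalDomain.mk'`), with respect to every measure. [cite: CasselsFrohlichANT1967, Ch. XV Thm. 4.1.3 (1)] -/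
theorem isFundamentalDomain_unipotentTateDomain [MeasurableSpace ↥(adelicUnipotent n K)]
    [BorelSpace ↥(adelicUnipotent n K)] (ν : Measure ↥(adelicUnipotent n K)) :
    IsFundamentalDomain ↥(rationalUnipotent n K) (unipotentTateDomain n K) ν :=
  IsFundamentalDomain.mk' measurableSet_unipotentTateDomain.nullMeasurableSet
    existsUnique_smul_mem_unipotentTateDomain

/-- The coordinate map `e ↦ (unitriangular matrix with upper entries e)` into `N_n(𝔸_K)`
(`unitriangularGL` of `UnipotentAdelicCompact`, corestricted). [folklore] -/
def unitriangularOfAdeles (e : Fin n → Fin n → AdeleRing (𝓞 K) K) : ↥(adelicUnipotent n K) :=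
  ⟨unitriangularGL e, unitriangularGL_mem e⟩

/-- `unitriangularOfAdeles` is continuous (`continuous_unitriangularGL`). [folklore] -/
theorem continuous_unitriangularOfAdeles :
    Continuous (unitriangularOfAdeles : (Fin n → Fin n → AdeleRing (𝓞 K) K) → ↥(adelicUnipotent n K)) :=
  continuous_unitriangularGL.subtype_mk _

/-- Every `u ∈ N_n(𝔸_K)` is `unitriangularOfAdeles` of its upper entries (extended by `0`).
[folklore] -/
theorem unitriangularOfAdeles_eq (u : ↥(adelicUnipotent n K)) :
    unitriangularOfAdeles (fun i j => if i < j then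
      ((u : GL (Fin n) (AdeleRing (𝓞 K) K)) : Matrix (Fin n) (Fin n) (AdeleRing (𝓞 K) K)) i j else 0) = u := by
  obtain ⟨hut, hud⟩ := (mem_upperUnitriangular_iff (u : GL (Fin n) (AdeleRing (𝓞 K) K))).1 u.2
  refine Subtype.ext (Units.ext ?_)
  change ((unitriangularGL _ : GL (Fin n) (AdeleRing (𝓞 K) K)) :
      Matrix (Fin n) (Fin n) (AdeleRing (𝓞 K) K)) = _
  rw [coe_unitriangularGL]
  exact unitriangularOfEntries_eq_of hut hud fun i j hij => by simp only [if_pos hij]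

/-- **`𝓕_N` is relatively compact**: it lies in the continuous image of the compact box
`(closure D)^{n × n}` (`isCompact_closure_adeleFundamentalDomain`, Tate's Cor. 4.1.1).
[cite: CasselsFrohlichANT1967, Ch. XV Cor. 4.1.1] -/
theorem exists_isCompact_unipotentTateDomain_subset :
    ∃ C : Set ↥(adelicUnipotent n K), IsCompact C ∧ unipotentTateDomain n K ⊆ C := by
  set box : Set (Fin n → Fin n → AdeleRing (𝓞 K) K) :=
    univ.pi fun _ => univ.pi fun _ => closure (adeleFundamentalDomain K) with hbox
  have hboxc : IsCompact box :=
    isCompact_univ_pi fun _ => isCompact_univ_pi fun _ => isCompact_closure_adeleFundamentalDomain K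
  refine ⟨unitriangularOfAdeles '' box, hboxc.image continuous_unitriangularOfAdeles, ?_⟩
  intro u hu
  refine ⟨_, ?_, unitriangularOfAdeles_eq u⟩
  refine mem_univ_pi.2 fun i => mem_univ_pi.2 fun j => ?_
  by_cases hij : i < j
  · simp only [if_pos hij]; exact subset_closure (hu i j hij)
  · simp only [if_neg hij]; exact subset_closure (zero_mem_adeleFundamentalDomain K)

/-- `𝓕_N` has compact closure. [cite: CasselsFrohlichANT1967, Ch. XV Cor. 4.1.1] -/
theorem isCompact_closure_unipotentTateDomain : IsCompact (closure (unipotentTateDomain n K)) := by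
  obtain ⟨C, hC, hsub⟩ := exists_isCompact_unipotentTateDomain_subset (n := n) (K := K)
  exact hC.closure_of_subset hsub

end Domain

/-! ### Haar measure: `0 < ν(𝓕_N) < ∞`, and `N_n(𝔸_K)` is unimodular -/

section Haar

variable {n : ℕ} {K : Type} [Field K] [NumberField K]
variable [MeasurableSpace ↥(adelicUnipotent n K)] [BorelSpace ↥(adelicUnipotent n K)]

omit [BorelSpace ↥(adelicUnipotent n K)] in
/-- `ν(𝓕_N) < ∞` for every measure finite on compact sets. [folklore] -/
theorem measure_unipotentTateDomain_lt_top (ν : Measure ↥(adelicUnipotent n K))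
    [IsFiniteMeasureOnCompacts ν] : ν (unipotentTateDomain n K) < ⊤ :=
  (measure_mono subset_closure).trans_lt isCompact_closure_unipotentTateDomain.measure_lt_top

/-- `0 < ν(𝓕_N)` for every non-zero `N_n(K)`-invariant measure (the translates of `𝓕_N` by the
countable group `N_n(K)` cover `N_n(𝔸_K)`), in particular for every Haar measure. [folklore] -/
theorem measure_unipotentTateDomain_pos (ν : Measure ↥(adelicUnipotent n K))
    [SMulInvariantMeasure ↥(rationalUnipotent n K) ↥(adelicUnipotent n K) ν] (hν : ν ≠ 0) :
    0 < ν (unipotentTateDomain n K) :=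
  pos_iff_ne_zero.2 ((isFundamentalDomain_unipotentTateDomain ν).measure_ne_zero hν)

/-- A Haar measure on `N_n(𝔸_K)` gives `𝓕_N` positive measure. [folklore] -/
theorem measure_unipotentTateDomain_pos_of_isHaarMeasure (ν : Measure ↥(adelicUnipotent n K))
    [IsHaarMeasure ν] : 0 < ν (unipotentTateDomain n K) := by
  refine measure_unipotentTateDomain_pos ν fun h => ?_
  have := isOpen_univ.measure_ne_zero ν univ_nonempty
  rw [h] at this
  exact this rfl

/-- **`N_n(𝔸_K)` is unimodular**: every left Haar measure on `N_n(𝔸_K)` is right invariant. The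
countable subgroup `N_n(K)` has the fundamental domain `𝓕_N` of finite positive measure, so the
modular function is trivial (`isMulRightInvariant_of_isFundamentalDomain`, `LatticeUnimodular`).
[folklore] -/
theorem isMulRightInvariant_of_isHaarMeasure_adelicUnipotent (ν : Measure ↥(adelicUnipotent n K))
    [IsHaarMeasure ν] : ν.IsMulRightInvariant :=
  isMulRightInvariant_of_isFundamentalDomain (rationalUnipotent n K) ν
    (isFundamentalDomain_unipotentTateDomain ν)
    (measure_unipotentTateDomain_pos_of_isHaarMeasure ν).ne'
    (measure_unipotentTateDomain_lt_top ν).ne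

variable (n K)

/-- **The datum of the global Whittaker coefficient exists.** On `N_n(𝔸_K)` (with its Borel
structure) there is a Haar measure `ν`, automatically right invariant and `N_n(K)`-invariant, and
Tate's box `𝓕_N` is a measurable fundamental domain for `N_n(K)` with compact closure and
`0 < ν(𝓕_N) < ∞` — the hypotheses `h𝓕`, `h𝓕c` and the instance hypotheses on `ν` of
`WhittakerCoeffCuspidal.whittakerCoeff_smoothedForm_ofLocal_piPowGL_eq` (Cogdell (2004), §1.1:
the integral defining `W_φ` "is over a compact set"). [folklore] -/
theorem exists_isHaarMeasure_isFundamentalDomain_adelicUnipotent :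
    ∃ ν : Measure ↥(adelicUnipotent n K), IsHaarMeasure ν ∧ ν.IsMulRightInvariant ∧
      SMulInvariantMeasure ↥(rationalUnipotent n K) ↥(adelicUnipotent n K) ν ∧
      IsFundamentalDomain ↥(rationalUnipotent n K) (unipotentTateDomain n K) ν ∧
      MeasurableSet (unipotentTateDomain n K) ∧ IsCompact (closure (unipotentTateDomain n K)) ∧
      0 < ν (unipotentTateDomain n K) ∧ ν (unipotentTateDomain n K) < ⊤ :=
  ⟨Measure.haar, inferInstance, isMulRightInvariant_of_isHaarMeasure_adelicUnipotent _, inferInstance,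
    isFundamentalDomain_unipotentTateDomain _, measurableSet_unipotentTateDomain,
    isCompact_closure_unipotentTateDomain, measure_unipotentTateDomain_pos_of_isHaarMeasure _,
    measure_unipotentTateDomain_lt_top _⟩

end Haar

end Literature.NumberTheory.Automorphic
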